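import Summits.QuantumFields.YangMills.Theorems.AlphaInputsT3ACv3SphereAxialGaugeTop
import Summits.QuantumFields.YangMills.Theorems.AlphaInputsT3ACv3ModelBox
import HarnessLib

/-!
# `AlphaInputsT3ACv3SphereAxialGauge` — non-abelian (FL), START v3 row (S3), part 4: **THE BOUNDARY GAUGE OF A LATTICE CUBE** — for `U : (Fin 3 → ℤ) → Fin 3 → SU(n)` whose plaquettes ON
# THE BOUNDARY of `[−R,R]³` are within `b` of `1`, with `320·R²·b ≤ 1` and `|n|·20R²b < π`, there is `σ : (Fin 3 → ℤ) → SU(n)` with `‖σ(u)·U(u,μ)·σ(u+e_μ)⁻¹ − 1‖ ≤ 200·R·b` on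
# EVERY boundary (tangential) bond — cell `ym3-torus`, width seat `ym-ust-19936-w5` (g2), row (S3) of ★w1-19936 g2 LEAD memo `NONABELIAN-FL-START-w1-g2.md` §3 (B)∕§4, in the LEAD's
# `…v3ModelBox` carriers (p597788: `InBox`, `BdryBond`, `BdryPlaq`, `plaqB`, `gaugeB`, `e μ = Pi.single μ 1`) — the `hW` input of `…v3ModelBoxLog.hA_of_dist1`∕`hB_of_dist1`∕`startB`

WHY (OWNER RULING 19936 (FL) START 2026-08-28T02:16:33Z, START v3 of record).  The vertex BALL of START v3 is filled from its boundary data (plaquettes `≤ b = 64εL^{−2k}` on the boundary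
of a cube of half-side `R ≍ L^k/4`) by ★w3's transfinite fill in a boundary gauge that must be UNIFORMLY `O(R·b)`-flat; no tree gauge is (2-sphere; located by this seat), so the gauge is
the five-face tree of part 1 (`…SphereAxialGaugeDisc`) + the Coons spreading of the top-face mismatch of parts 2–3 (`…Ring`, `…Top`).  THIS FILE translates the model hypotheses
(boundary plaquettes of `U` in the `Fin 3 → ℤ` carriers) into the offset plaquette families of parts 1–3, defines `σ`, and proves the bound bond class by bond class.
WHAT.  `vec3_eta`, `vec3_add_e₀∕₁∕₂`; `ofBox U` (def: `U` read at `![x,y,z]`), `sigmaBox U R` (def: `σ_top` on the face `u 2 = R`, `σ_T` elsewhere; they agree on the top ring);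
`plaq_bounds` (the three face families `pXY` (bottom∕top), `pYZ` (faces `x = ±R`), `pXZ` (faces `y = ±R`) from the hypothesis); `sigmaBox_offsets`; ★★★ `exists_sphereAxialGauge`.
CONSTANTS (honest): `z`-bonds `0`; side∕bottom bonds `≤ 4R·b`; top columns `≤ (8/5)(4/3 + 20)·2R·b < 69R·b`; top rungs `≤ 4R·b + (8/5)(16/3 + 40)·2R·b < 150R·b`; stated `200·R·b`.
SMALLNESS.  `320·R²·b ≤ 1` and `|n|·(20R²b) < π` (void for `n = Fin 2`); in START v3 (B) `R²b = 4ε`: the row is `1280·ε ≤ 1`, absolute.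
HONEST FRAMING.  Bookkeeping over parts 1–3; count-neutral helper toward R3 2′ (items 19936∕19935, `--supports stmt-QuantumFields-19936`); `hLift`∕(FL), the stub `stub_laneRecordsV3Chi`,
the crux `HistoryTailL` and the gap are NOT claimed; registry untouched; YM₃ on T³ is rung R3 of the YM ladder, not the Clay problem.

References: T. Bałaban, Commun. Math. Phys. 98 (1985) 17–51 [Balaban1985Averaging] ((8)–(9) p.18, (19)–(20) p.21, pp.24–25); Commun. Math. Phys. 99 (1985) 75–102 [Balaban1985RegularSpaces]
(Lemma 1 (1.24)–(1.25) p.79); Commun. Math. Phys. 102 (1985) 277–309 [Balaban1985Variational] ((15), (18) p.280).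
-/

set_option autoImplicit false

noncomputable section

open scoped Matrix.Norms.L2Operator
open NormedSpace

namespace Summit.QuantumFields.YangMills.Theorems.SphereAxialGauge

open Literature.MathematicalPhysics.QuantumFieldTheory.Balaban1983to89
open Literature.MathematicalPhysics.QuantumFieldTheory.Balaban1983to89.T4AdjointCovarianceUnitary (lieSU expSU coe_expSU)
open Summit.QuantumFields.YangMills.Theorems.ModelBox (e InBox BondInBox BdryBond PlaqInBox BdryPlaq plaqB gaugeB plaqB_def gaugeB_def)

variable {n : Type*} [Fintype n] [DecidableEq n] [Nonempty n]

/-! ## §1 The `Fin 3 → ℤ` carriers -/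

omit [Fintype n] [DecidableEq n] [Nonempty n] in
/-- `u = ![u 0, u 1, u 2]`. [folklore] -/
theorem vec3_eta (u : Fin 3 → ℤ) : u = ![u 0, u 1, u 2] := by
  ext i; fin_cases i <;> rfl

omit [Fintype n] [DecidableEq n] [Nonempty n] in
/-- `![x,y,z] + e₀ = ![x+1,y,z]`. [folklore] -/
theorem vec3_add_e₀ (x y z : ℤ) : ![x, y, z] + e (0 : Fin 3) = ![x + 1, y, z] := by
  ext i; fin_cases i <;> simp [e]

omit [Fintype n] [DecidableEq n] [Nonempty n] in
/-- `![x,y,z] + e₁ = ![x,y+1,z]`. [folklore] -/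
theorem vec3_add_e₁ (x y z : ℤ) : ![x, y, z] + e (1 : Fin 3) = ![x, y + 1, z] := by
  ext i; fin_cases i <;> simp [e]

omit [Fintype n] [DecidableEq n] [Nonempty n] in
/-- `![x,y,z] + e₂ = ![x,y,z+1]`. [folklore] -/
theorem vec3_add_e₂ (x y z : ℤ) : ![x, y, z] + e (2 : Fin 3) = ![x, y, z + 1] := by
  ext i; fin_cases i <;> simp [e]

/-- The model field read in integer coordinates: `W x y z μ := U ![x,y,z] μ`. [folklore] -/
def ofBox (U : (Fin 3 → ℤ) → Fin 3 → Matrix.specialUnitaryGroup n ℂ) : ℤ → ℤ → ℤ → Fin 3 → Matrix.specialUnitaryGroup n ℂ := fun x y z μ => U ![x, y, z] μ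

/-- **THE BOUNDARY GAUGE OF THE CUBE**: the Coons-corrected top gauge `σ_top` on the face `u 2 = R`, the five-face tree gauge `σ_T` elsewhere (offsets `u i + R` from the corner).
[cite: Balaban1985Averaging, pp.24–25] -/
def sigmaBox (U : (Fin 3 → ℤ) → Fin 3 → Matrix.specialUnitaryGroup n ℂ) (R : ℕ) (u : Fin 3 → ℤ) : Matrix.specialUnitaryGroup n ℂ :=
  if u 2 = (R : ℤ) then sigmaTop (ofBox U) R (u 0 + R).toNat (u 1 + R).toNat else sigmaT (ofBox U) R (u 0 + R).toNat (u 1 + R).toNat (u 2 + R).toNat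

/-- `σ` at offsets: `σ(−R+a, −R+s, −R+t)` is `σ_top(a,s)` if `t = 2R`, else `σ_T(a,s,t)`. [folklore] -/
theorem sigmaBox_offsets (U : (Fin 3 → ℤ) → Fin 3 → Matrix.specialUnitaryGroup n ℂ) (R a s t : ℕ) :
    sigmaBox U R ![-(R : ℤ) + a, -(R : ℤ) + s, -(R : ℤ) + t] = if t = 2 * R then sigmaTop (ofBox U) R a s else sigmaT (ofBox U) R a s t := by
  have e0 : (-(R : ℤ) + a + R).toNat = a := by rw [show (-(R : ℤ) + a + R) = (a : ℤ) by ring, Int.toNat_natCast]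
  have e1 : (-(R : ℤ) + s + R).toNat = s := by rw [show (-(R : ℤ) + s + R) = (s : ℤ) by ring, Int.toNat_natCast]
  have e2 : (-(R : ℤ) + t + R).toNat = t := by rw [show (-(R : ℤ) + t + R) = (t : ℤ) by ring, Int.toNat_natCast]
  have hiff : (-(R : ℤ) + t = R) ↔ t = 2 * R := by omega
  unfold sigmaBox
  simp only [Matrix.cons_val_zero, Matrix.cons_val_one, Matrix.head_cons, Matrix.cons_val_two, Matrix.tail_cons, e0, e1, e2]
  by_cases ht : t = 2 * R
  · rw [if_pos (hiff.mpr ht), if_pos ht]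
  · rw [if_neg (fun h => ht (hiff.mp h)), if_neg ht]

/-- **THE THREE FACE FAMILIES OF PLAQUETTE BOUNDS** from the model hypothesis «every boundary plaquette within `b`»: `pXY` on the faces `z = ±R`, `pYZ` on `x = ±R`, `pXZ` on `y = ±R`
(offsets `< 2R` keep all four corners in the box). [cite: Balaban1985Averaging, (9) p.18] -/
theorem plaq_bounds (U : (Fin 3 → ℤ) → Fin 3 → Matrix.specialUnitaryGroup n ℂ) (R : ℕ) {b : ℝ}
    (hU : ∀ (u : Fin 3 → ℤ) (μ ν : Fin 3), BdryPlaq R u μ ν → dist1 (plaqB U u μ ν) ≤ b) :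
    (∀ (a i : ℕ) (z : ℤ), a < 2 * R → i < 2 * R → (z = -(R : ℤ) ∨ z = R) → dist1 (pXY (ofBox U) (-(R : ℤ) + a) (-(R : ℤ) + i) z) ≤ b) ∧
    (∀ (s i : ℕ) (x : ℤ), s < 2 * R → i < 2 * R → (x = -(R : ℤ) ∨ x = R) → dist1 (pYZ (ofBox U) x (-(R : ℤ) + s) (-(R : ℤ) + i)) ≤ b) ∧
    (∀ (a i : ℕ) (y : ℤ), a < 2 * R → i < 2 * R → (y = -(R : ℤ) ∨ y = R) → dist1 (pXZ (ofBox U) (-(R : ℤ) + a) y (-(R : ℤ) + i)) ≤ b) := by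
  have habs : ∀ w : ℤ, (w = -(R : ℤ) ∨ w = R) → |w| = R := fun w hw => by rcases hw with rfl | rfl <;> simp
  have hle : ∀ (k : ℕ), k ≤ 2 * R → |(-(R : ℤ) + k)| ≤ R := fun k hk => abs_le.mpr ⟨by omega, by omega⟩
  -- `InBox` of an explicit vector from its three coordinates
  have hbox : ∀ x y z : ℤ, |x| ≤ R → |y| ≤ R → |z| ≤ R → InBox R ![x, y, z] := fun x y z hx hy hz j => by
    fin_cases j
    · simpa using hx
    · simpa using hy
    · simpa using hz
  refine ⟨fun a i z ha hi hz => ?_, fun s i x hs hi hx => ?_, fun a i y ha hi hy => ?_⟩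
  · have hP : BdryPlaq R ![-(R : ℤ) + a, -(R : ℤ) + i, z] 0 1 := by
      refine ⟨⟨hbox _ _ _ (hle a ha.le) (hle i hi.le) (habs z hz).le, ?_, ?_, ?_⟩, 2, by decide, by decide, by simpa using habs z hz⟩
      · rw [vec3_add_e₀]; exact hbox _ _ _ (by simpa [add_assoc] using hle (a + 1) (by omega)) (hle i hi.le) (habs z hz).le
      · rw [vec3_add_e₁]; exact hbox _ _ _ (hle a ha.le) (by simpa [add_assoc] using hle (i + 1) (by omega)) (habs z hz).le
      · rw [vec3_add_e₀, vec3_add_e₁]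
        exact hbox _ _ _ (by simpa [add_assoc] using hle (a + 1) (by omega)) (by simpa [add_assoc] using hle (i + 1) (by omega)) (habs z hz).le
    have h := hU _ 0 1 hP
    simpa only [plaqB_def, pXY, ofBox, vec3_add_e₀, vec3_add_e₁] using h
  · have hP : BdryPlaq R ![x, -(R : ℤ) + s, -(R : ℤ) + i] 1 2 := by
      refine ⟨⟨hbox _ _ _ (habs x hx).le (hle s hs.le) (hle i hi.le), ?_, ?_, ?_⟩, 0, by decide, by decide, by simpa using habs x hx⟩
      · rw [vec3_add_e₁]; exact hbox _ _ _ (habs x hx).le (by simpa [add_assoc] using hle (s + 1) (by omega)) (hle i hi.le)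
      · rw [vec3_add_e₂]; exact hbox _ _ _ (habs x hx).le (hle s hs.le) (by simpa [add_assoc] using hle (i + 1) (by omega))
      · rw [vec3_add_e₁, vec3_add_e₂]
        exact hbox _ _ _ (habs x hx).le (by simpa [add_assoc] using hle (s + 1) (by omega)) (by simpa [add_assoc] using hle (i + 1) (by omega))
    have h := hU _ 1 2 hP
    simpa only [plaqB_def, pYZ, ofBox, vec3_add_e₁, vec3_add_e₂] using h
  · have hP : BdryPlaq R ![-(R : ℤ) + a, y, -(R : ℤ) + i] 0 2 := by
      refine ⟨⟨hbox _ _ _ (hle a ha.le) (habs y hy).le (hle i hi.le), ?_, ?_, ?_⟩, 1, by decide, by decide, by simpa using habs y hy⟩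
      · rw [vec3_add_e₀]; exact hbox _ _ _ (by simpa [add_assoc] using hle (a + 1) (by omega)) (habs y hy).le (hle i hi.le)
      · rw [vec3_add_e₂]; exact hbox _ _ _ (hle a ha.le) (habs y hy).le (by simpa [add_assoc] using hle (i + 1) (by omega))
      · rw [vec3_add_e₀, vec3_add_e₂]
        exact hbox _ _ _ (by simpa [add_assoc] using hle (a + 1) (by omega)) (habs y hy).le (by simpa [add_assoc] using hle (i + 1) (by omega))
    have h := hU _ 0 2 hP
    simpa only [plaqB_def, pXZ, ofBox, vec3_add_e₀, vec3_add_e₂] using h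

omit [Nonempty n] in
/-- `‖V′ − V‖ = dist1(V′·V⁻¹)` in `SU(n)`. [folklore] -/
theorem norm_coe_sub_coe_eq_dist1 [Nonempty n] (V V' : Matrix.specialUnitaryGroup n ℂ) :
    ‖(V' : Matrix n n ℂ) - (V : Matrix n n ℂ)‖ = dist1 (V' * V⁻¹) := by
  rw [FederbushMean.dist1_SU_eq, Submonoid.coe_mul]
  have hinv : ((V⁻¹ : Matrix.specialUnitaryGroup n ℂ) : Matrix n n ℂ) = star (V : Matrix n n ℂ) := rfl
  have hV : star (V : Matrix n n ℂ) * (V : Matrix n n ℂ) = 1 := Matrix.mem_unitaryGroup_iff'.mp (Matrix.specialUnitaryGroup_le_unitaryGroup V.2)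
  have e : (V' : Matrix n n ℂ) - (V : Matrix n n ℂ) = ((V' : Matrix n n ℂ) * star (V : Matrix n n ℂ) - 1) * (V : Matrix n n ℂ) := by
    rw [sub_mul, one_mul, mul_assoc, hV, mul_one]
  rw [e, CStarRing.norm_mul_mem_unitary _ V.2.1, hinv]

/-! ## §2 The theorem -/

/-- **★★★ (S3) THE BOUNDARY GAUGE OF A LATTICE CUBE.**  Let `U : (Fin 3 → ℤ) → Fin 3 → SU(n)` (bond variable on `(u, u + e_μ)`, `e_μ = Pi.single μ 1`), `R ≥ 1`, `0 ≤ b` with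
`320·R²·b ≤ 1` and `|n|·(20R²b) < π`, and suppose every BOUNDARY plaquette of the box `[−R,R]³` — `(u; μ, ν)`, `μ ≠ ν`, with `u` and `u + e_μ + e_ν` in the box and `|u_i| = R` for the
third index `i` — satisfies `dist1(U u μ · U (u+e_μ) ν · (U (u+e_ν) μ)⁻¹ · (U u ν)⁻¹) ≤ b`.  Then there is a gauge `σ : (Fin 3 → ℤ) → SU(n)` such that EVERY BOUNDARY (tangential) BOND
`(u, μ)` — `u`, `u + e_μ` in the box and `|u_i| = R` for some `i ≠ μ` — has `dist1(σ(u)·U(u,μ)·σ(u+e_μ)⁻¹) = ‖gaugeB σ U u μ − 1‖ ≤ 200·R·b` (ModelBox carriers; the values of `σ` off the boundary shell are irrelevant).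
[cite: Balaban1985Averaging, (8)–(9) p.18, (19)–(20) p.21, pp.24–25; Balaban1985RegularSpaces, Lemma 1 (1.24)–(1.25) p.79] -/
theorem exists_sphereAxialGauge (R : ℕ) (hR : 1 ≤ R) (U : (Fin 3 → ℤ) → Fin 3 → Matrix.specialUnitaryGroup n ℂ) {b : ℝ} (hb : 0 ≤ b)
    (hsmall : 320 * (R : ℝ) ^ 2 * b ≤ 1) (hπ : (Fintype.card n : ℝ) * (20 * (R : ℝ) ^ 2 * b) < Real.pi)
    (hU : ∀ (u : Fin 3 → ℤ) (μ ν : Fin 3), BdryPlaq R u μ ν → dist1 (plaqB U u μ ν) ≤ b) :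
    ∃ σ : (Fin 3 → ℤ) → Matrix.specialUnitaryGroup n ℂ, ∀ (u : Fin 3 → ℤ) (μ : Fin 3), BdryBond R u μ → dist1 (gaugeB σ U u μ) ≤ 200 * R * b := by
  obtain ⟨hPXY, hPYZ, hPXZ⟩ := plaq_bounds U R hU
  set W := ofBox U with hW
  -- numeric rows
  have hRpos : (0 : ℝ) < R := by exact_mod_cast hR
  have hN : ((2 * R : ℕ) : ℝ) = 2 * R := by push_cast; ring
  have hRb : 0 ≤ (R : ℝ) * b := mul_nonneg hRpos.le hb
  have hm16 : 5 * ((2 * R : ℕ) : ℝ) ^ 2 * b ≤ 1 / 16 := by rw [hN]; nlinarith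
  -- §A the ring mismatch is small all around the ring
  have hside : ∀ a s : ℕ, (a = 0 ∨ a = 2 * R) → s ≤ 2 * R → dist1 (nu W R a s) ≤ s * ((2 * R : ℕ) * b) := fun a s ha hs =>
    dist1_nu_sideEdge_le W R a (fun s' i hs' hi => hPYZ s' i _ hs' hi (by rcases ha with rfl | rfl <;> [left; right] <;> push_cast <;> ring)) s hs
  have htop : ∀ a : ℕ, a ≤ 2 * R → dist1 (nu W R a (2 * R)) ≤ (2 * R : ℕ) * ((2 * R : ℕ) * b) + a * (4 * ((2 * R : ℕ) * b)) :=
    dist1_nu_topEdge_le W R (fun s i hs hi => hPYZ s i _ hs hi (Or.inl rfl)) (fun a i ha hi => hPXZ a i _ ha hi (Or.inr (by push_cast; ring)))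
      (fun a i ha hi => hPXY a i _ ha hi (Or.inl rfl)) (fun a i ha hi => hPXY a i _ ha hi (Or.inr (by push_cast; ring))) (fun a i ha hi => hPXZ a i _ ha hi (Or.inl rfl))
  have hring : ∀ a s : ℕ, a ≤ 2 * R → s ≤ 2 * R → (a = 0 ∨ a = 2 * R ∨ s = 0 ∨ s = 2 * R) →
      ‖((nu W R a s : Matrix.specialUnitaryGroup n ℂ) : Matrix n n ℂ) - 1‖ ≤ 5 * ((2 * R : ℕ) : ℝ) ^ 2 * b := by
    intro a s ha hs hr
    rw [← FederbushMean.dist1_SU_eq]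
    have has : (a : ℝ) ≤ (2 * R : ℕ) := by exact_mod_cast ha
    have hss : (s : ℝ) ≤ (2 * R : ℕ) := by exact_mod_cast hs
    have hNb : 0 ≤ ((2 * R : ℕ) : ℝ) * b := by positivity
    have hN2b : 0 ≤ ((2 * R : ℕ) : ℝ) ^ 2 * b := by positivity
    have hsq : ((2 * R : ℕ) : ℝ) * (((2 * R : ℕ) : ℝ) * b) = ((2 * R : ℕ) : ℝ) ^ 2 * b := by ring
    have hsideN : ∀ a', (a' = 0 ∨ a' = 2 * R) → dist1 (nu W R a' s) ≤ 5 * ((2 * R : ℕ) : ℝ) ^ 2 * b := fun a' ha' =>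
      calc dist1 (nu W R a' s) ≤ s * (((2 * R : ℕ) : ℝ) * b) := hside a' s ha' hs
        _ ≤ ((2 * R : ℕ) : ℝ) * (((2 * R : ℕ) : ℝ) * b) := mul_le_mul_of_nonneg_right hss hNb
        _ ≤ 5 * ((2 * R : ℕ) : ℝ) ^ 2 * b := by rw [hsq]; linarith
    rcases hr with h | h | h | h
    · exact hsideN a (Or.inl h)
    · exact hsideN a (Or.inr h)
    · subst h; rw [nu_zero_s, GaugeGroup.dist1_one]; positivity
    · subst h
      calc dist1 (nu W R a (2 * R)) ≤ (2 * R : ℕ) * ((2 * R : ℕ) * b) + a * (4 * ((2 * R : ℕ) * b)) := htop a ha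
        _ ≤ (2 * R : ℕ) * ((2 * R : ℕ) * b) + (2 * R : ℕ) * (4 * ((2 * R : ℕ) * b)) := by gcongr
        _ = 5 * ((2 * R : ℕ) : ℝ) ^ 2 * b := by ring
  have hsm : ∀ a s : ℕ, a ≤ 2 * R → s ≤ 2 * R → (a = 0 ∨ a = 2 * R ∨ s = 0 ∨ s = 2 * R) →
      ‖((nu W R a s : Matrix.specialUnitaryGroup n ℂ) : Matrix n n ℂ) - 1‖ ≤ 1 / 4 ∧
        (Fintype.card n : ℝ) * ‖((nu W R a s : Matrix.specialUnitaryGroup n ℂ) : Matrix n n ℂ) - 1‖ < Real.pi := by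
    intro a s ha hs hr
    have h := hring a s ha hs hr
    refine ⟨h.trans (hm16.trans (by norm_num)), lt_of_le_of_lt (mul_le_mul_of_nonneg_left h (Nat.cast_nonneg _)) ?_⟩
    have e5 : (Fintype.card n : ℝ) * (5 * ((2 * R : ℕ) : ℝ) ^ 2 * b) = (Fintype.card n : ℝ) * (20 * (R : ℝ) ^ 2 * b) := by rw [hN]; ring
    rw [e5]; exact hπ
  -- §B the ring logarithm: size and Lipschitz bounds
  have hF : ∀ a s : ℕ, a ≤ 2 * R → s ≤ 2 * R → (a = 0 ∨ a = 2 * R ∨ s = 2 * R) → ‖((Fnu W R a s : lieSU n) : Matrix n n ℂ)‖ ≤ 10 * ((2 * R : ℕ) : ℝ) ^ 2 * b := by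
    intro a s ha hs hr
    have hr' : a = 0 ∨ a = 2 * R ∨ s = 0 ∨ s = 2 * R := by rcases hr with h | h | h <;> simp [h]
    exact (norm_logSU_le _).trans (by linarith [hring a s ha hs hr'])
  have hLs : ∀ a s : ℕ, (a = 0 ∨ a = 2 * R) → s + 1 ≤ 2 * R →
      ‖((Fnu W R a (s + 1) : lieSU n) : Matrix n n ℂ) - ((Fnu W R a s : lieSU n) : Matrix n n ℂ)‖ ≤ 4 / 3 * ((2 * R : ℕ) * b) := by
    intro a s ha hs
    have ha' : a ≤ 2 * R := by rcases ha with rfl | rfl <;> omega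
    have hr1 : a = 0 ∨ a = 2 * R ∨ s + 1 = 0 ∨ s + 1 = 2 * R := by rcases ha with h | h <;> simp [h]
    have hr0 : a = 0 ∨ a = 2 * R ∨ s = 0 ∨ s = 2 * R := by rcases ha with h | h <;> simp [h]
    refine (norm_logSU_sub_logSU_le _ _ (hsm a (s + 1) ha' hs hr1) (hsm a s ha' (by omega) hr0)).trans ?_
    rw [norm_coe_sub_coe_eq_dist1]
    exact mul_le_mul_of_nonneg_left (dist1_nu_succ_s_le W R a s (fun i hi => hPYZ s i _ (by omega) hi (by rcases ha with rfl | rfl <;> [left; right] <;> push_cast <;> ring)))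
      (by norm_num)
  have hLa : ∀ a : ℕ, a + 1 ≤ 2 * R →
      ‖((Fnu W R (a + 1) (2 * R) : lieSU n) : Matrix n n ℂ) - ((Fnu W R a (2 * R) : lieSU n) : Matrix n n ℂ)‖ ≤ 4 / 3 * (4 * ((2 * R : ℕ) * b)) := by
    intro a ha
    refine (norm_logSU_sub_logSU_le _ _ (hsm (a + 1) (2 * R) ha le_rfl (by simp)) (hsm a (2 * R) (by omega) le_rfl (by simp))).trans ?_
    rw [norm_coe_sub_coe_eq_dist1]
    refine mul_le_mul_of_nonneg_left ?_ (by norm_num)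
    have h := dist1_nu_succ_a_le W R a (2 * R) (fun i hi => hPXZ a i _ (by omega) hi (Or.inr (by push_cast; ring))) (fun i hi => hPXY a i _ (by omega) hi (Or.inl rfl))
      (fun i hi => hPXY a i _ (by omega) hi (Or.inr (by push_cast; ring))) (fun i hi => hPXZ a i _ (by omega) hi (Or.inl rfl))
    exact h.trans (le_of_eq (by ring))
  -- §C the Coons interpolant: sup and Lipschitz
  have hψ : ∀ a s : ℕ, a ≤ 2 * R → s ≤ 2 * R → ‖((psi W R a s : lieSU n) : Matrix n n ℂ)‖ ≤ 3 / 8 := fun a s ha hs =>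
    (norm_psi_le hR hF a s ha hs).trans (by rw [hN] at hm16 ⊢; nlinarith)
  have hψa : ∀ a s : ℕ, a + 1 ≤ 2 * R → s ≤ 2 * R →
      ‖((psi W R (a + 1) s : lieSU n) : Matrix n n ℂ) - ((psi W R a s : lieSU n) : Matrix n n ℂ)‖ ≤ 46 * ((2 * R : ℕ) * b) := by
    intro a s ha hs
    refine (norm_psi_succ_a_sub_le hR hF hLa a s ha hs).trans ?_
    rw [hN]; field_simp; nlinarith
  have hψs : ∀ a s : ℕ, a ≤ 2 * R → s + 1 ≤ 2 * R →
      ‖((psi W R a (s + 1) : lieSU n) : Matrix n n ℂ) - ((psi W R a s : lieSU n) : Matrix n n ℂ)‖ ≤ 22 * ((2 * R : ℕ) * b) := by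
    intro a s ha hs
    refine (norm_psi_succ_s_sub_le hR hF hLs a s ha hs).trans ?_
    rw [hN]; field_simp; nlinarith
  -- §D the bonds
  refine ⟨sigmaBox U R, fun u μ hB => ?_⟩
  obtain ⟨⟨hbox, hbox'⟩, hbdry⟩ := hB
  rw [gaugeB_def]
  -- offsets of `u`
  obtain ⟨a, ha⟩ : ∃ a : ℕ, u 0 = -(R : ℤ) + a := ⟨(u 0 + R).toNat, by have := abs_le.mp (hbox 0); omega⟩
  obtain ⟨s, hs⟩ : ∃ s : ℕ, u 1 = -(R : ℤ) + s := ⟨(u 1 + R).toNat, by have := abs_le.mp (hbox 1); omega⟩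
  obtain ⟨t, ht⟩ : ∃ t : ℕ, u 2 = -(R : ℤ) + t := ⟨(u 2 + R).toNat, by have := abs_le.mp (hbox 2); omega⟩
  have haN : a ≤ 2 * R := by have := abs_le.mp (hbox 0); omega
  have hsN : s ≤ 2 * R := by have := abs_le.mp (hbox 1); omega
  have htN : t ≤ 2 * R := by have := abs_le.mp (hbox 2); omega
  have hu : u = ![-(R : ℤ) + a, -(R : ℤ) + s, -(R : ℤ) + t] := by rw [vec3_eta u, ha, hs, ht]
  -- reading `|−R + k| = R`
  have habs : ∀ k : ℕ, |(-(R : ℤ) + k)| = R → k = 0 ∨ k = 2 * R := fun k hk => by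
    rcases (abs_eq (by positivity : (0 : ℤ) ≤ R)).mp hk with h | h <;> omega
  have h2R : -(R : ℤ) + ((2 * R : ℕ) : ℤ) = R := by push_cast; ring
  have hμ : μ = 0 ∨ μ = 1 ∨ μ = 2 := by fin_cases μ <;> simp
  rcases hμ with rfl | rfl | rfl
  · -- x-bonds
    have ha1 : a + 1 ≤ 2 * R := by have := abs_le.mp (hbox' 0); rw [ModelBox.add_e_apply_same, ha] at this; omega
    have hshift : u + e (0 : Fin 3) = ![-(R : ℤ) + ((a + 1 : ℕ) : ℤ), -(R : ℤ) + s, -(R : ℤ) + t] := by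
      rw [hu, vec3_add_e₀]; push_cast; ring_nf
    rw [hshift, hu, sigmaBox_offsets, sigmaBox_offsets]
    by_cases htt : t = 2 * R
    · -- top rung
      subst htt
      rw [if_pos rfl, if_pos rfl]
      have e : U ![-(R : ℤ) + a, -(R : ℤ) + s, -(R : ℤ) + ((2 * R : ℕ) : ℤ)] 0 = W (-(R : ℤ) + a) (-(R : ℤ) + s) (-(R : ℤ) + (2 * R : ℕ)) 0 := rfl
      rw [e, gaugedTopX_eq]
      have hrung := dist1_rung_le W R a s (fun i hi => hPXY a i _ (by omega) (by omega) (Or.inr h2R)) (fun i hi => hPXZ a i _ (by omega) hi (Or.inl rfl))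
      have h := norm_gaugedTop_sub_one_le (rung W R a s) (psi W R a s) (psi W R (a + 1) s) (hψ a s haN hsN) (hψ (a + 1) s ha1 hsN)
      rw [← FederbushMean.dist1_SU_eq] at h
      refine h.trans ?_
      rw [norm_sub_rev]
      have h3 := hψa a s ha1 hsN
      have hsb : (s : ℝ) * b ≤ (2 * R : ℕ) * b := mul_le_mul_of_nonneg_right (by exact_mod_cast hsN) hb
      rw [hN] at hrung hsb h3
      nlinarith [hrung, hsb, h3, hRb, norm_nonneg (((psi W R (a + 1) s : lieSU n) : Matrix n n ℂ) - ((psi W R a s : lieSU n) : Matrix n n ℂ))]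
    · rw [if_neg htt, if_neg htt]
      have e : U ![-(R : ℤ) + a, -(R : ℤ) + s, -(R : ℤ) + t] 0 = W (-(R : ℤ) + a) (-(R : ℤ) + s) (-(R : ℤ) + t) 0 := rfl
      rw [e]
      have htlt : t < 2 * R := lt_of_le_of_ne htN htt
      -- the (x,z)-ladder lies in a face `y = ±R` unless it is empty
      have hpZ : ∀ i : ℕ, i < t → dist1 (pXZ W (-(R : ℤ) + a) (-(R : ℤ) + s) (-(R : ℤ) + i)) ≤ b := by
        intro i hi
        obtain ⟨j, hj, hja⟩ := hbdry
        have hj' : j = 1 ∨ j = 2 := by fin_cases j <;> first | exact absurd rfl hj | decide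
        rcases hj' with rfl | rfl
        · rw [hs] at hja
          rcases habs s hja with h | h
          · exact hPXZ a i _ (by omega) (by omega) (Or.inl (by rw [h]; simp))
          · exact hPXZ a i _ (by omega) (by omega) (Or.inr (by rw [h]; exact h2R))
        · rw [ht] at hja
          rcases habs t hja with h | h <;> omega
      have h := dist1_gaugedX_le W R a s t hpZ (fun i hi => hPXY a i _ (by omega) (by omega) (Or.inl rfl))
      refine h.trans ?_
      have h1 : (t : ℝ) * b ≤ (2 * R : ℕ) * b := mul_le_mul_of_nonneg_right (by exact_mod_cast htN) hb
      have h2 : (s : ℝ) * b ≤ (2 * R : ℕ) * b := mul_le_mul_of_nonneg_right (by exact_mod_cast hsN) hb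
      rw [hN] at h1 h2
      nlinarith [h1, h2, hRb]
  · -- y-bonds
    have hs1 : s + 1 ≤ 2 * R := by have := abs_le.mp (hbox' 1); rw [ModelBox.add_e_apply_same, hs] at this; omega
    have hshift : u + e (1 : Fin 3) = ![-(R : ℤ) + a, -(R : ℤ) + ((s + 1 : ℕ) : ℤ), -(R : ℤ) + t] := by
      rw [hu, vec3_add_e₁]; push_cast; ring_nf
    rw [hshift, hu, sigmaBox_offsets, sigmaBox_offsets]
    by_cases htt : t = 2 * R
    · subst htt
      rw [if_pos rfl, if_pos rfl]
      have e : U ![-(R : ℤ) + a, -(R : ℤ) + s, -(R : ℤ) + ((2 * R : ℕ) : ℤ)] 1 = W (-(R : ℤ) + a) (-(R : ℤ) + s) (-(R : ℤ) + (2 * R : ℕ)) 1 := rfl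
      rw [e, gaugedTopY_eq]
      have h := norm_gaugedTop_sub_one_le 1 (psi W R a s) (psi W R a (s + 1)) (hψ a s haN hsN) (hψ a (s + 1) haN hs1)
      rw [← FederbushMean.dist1_SU_eq, GaugeGroup.dist1_one, zero_add] at h
      refine h.trans ?_
      rw [norm_sub_rev]
      have h3 := hψs a s haN hs1
      rw [hN] at h3
      nlinarith [h3, hRb]
    · rw [if_neg htt, if_neg htt]
      have e : U ![-(R : ℤ) + a, -(R : ℤ) + s, -(R : ℤ) + t] 1 = W (-(R : ℤ) + a) (-(R : ℤ) + s) (-(R : ℤ) + t) 1 := rfl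
      rw [e]
      have hpS : ∀ i : ℕ, i < t → dist1 (pYZ W (-(R : ℤ) + a) (-(R : ℤ) + s) (-(R : ℤ) + i)) ≤ b := by
        intro i hi
        obtain ⟨j, hj, hja⟩ := hbdry
        have hj' : j = 0 ∨ j = 2 := by fin_cases j <;> first | exact absurd rfl hj | decide
        rcases hj' with rfl | rfl
        · rw [ha] at hja
          rcases habs a hja with h | h
          · exact hPYZ s i _ (by omega) (by omega) (Or.inl (by rw [h]; simp))
          · exact hPYZ s i _ (by omega) (by omega) (Or.inr (by rw [h]; exact h2R))
        · rw [ht] at hja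
          rcases habs t hja with h | h <;> omega
      have h := dist1_gaugedY_le W R a s t hpS
      refine h.trans ?_
      have h1 : (t : ℝ) * b ≤ (2 * R : ℕ) * b := mul_le_mul_of_nonneg_right (by exact_mod_cast htN) hb
      rw [hN] at h1
      nlinarith [h1, hRb]
  · -- z-bonds
    have ht1 : t + 1 ≤ 2 * R := by have := abs_le.mp (hbox' 2); rw [ModelBox.add_e_apply_same, ht] at this; omega
    have hshift : u + e (2 : Fin 3) = ![-(R : ℤ) + a, -(R : ℤ) + s, -(R : ℤ) + ((t + 1 : ℕ) : ℤ)] := by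
      rw [hu, vec3_add_e₂]; push_cast; ring_nf
    rw [hshift, hu, sigmaBox_offsets, sigmaBox_offsets, if_neg (by omega : t ≠ 2 * R)]
    have e : U ![-(R : ℤ) + a, -(R : ℤ) + s, -(R : ℤ) + t] 2 = W (-(R : ℤ) + a) (-(R : ℤ) + s) (-(R : ℤ) + t) 2 := rfl
    rw [e]
    have htop' : (if t + 1 = 2 * R then sigmaTop W R a s else sigmaT W R a s (t + 1)) = sigmaT W R a s (t + 1) := by
      by_cases htt : t + 1 = 2 * R
      · rw [if_pos htt]
        obtain ⟨j, hj, hja⟩ := hbdry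
        have hj' : j = 0 ∨ j = 1 := by fin_cases j <;> first | exact absurd rfl hj | decide
        have hr : a = 0 ∨ a = 2 * R ∨ s = 0 ∨ s = 2 * R := by
          rcases hj' with rfl | rfl
          · rw [ha] at hja; rcases habs a hja with h | h <;> simp [h]
          · rw [hs] at hja; rcases habs s hja with h | h <;> simp [h]
        rw [sigmaTop_eq_sigmaT_of_ring W R hR a s hr (hsm a s haN hsN hr), htt]
      · rw [if_neg htt]
    rw [htop', gaugedZ_eq_one, GaugeGroup.dist1_one]
    positivity

end Summit.QuantumFields.YangMills.Theorems.SphereAxialGauge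

end
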